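import Literature.MathematicalPhysics.QuantumFieldTheory.Balaban1983to89.B9Eq3136HstarJBound
import Literature.MathematicalPhysics.QuantumFieldTheory.Balaban1983to89.B9RWSums347DefiniteFaces
import Literature.MathematicalPhysics.QuantumFieldTheory.Balaban1983to89.B9RWSumsDefinitePins
import Literature.MathematicalPhysics.QuantumFieldTheory.Balaban1983to89.B9Ineq349SiteFromBlocks
import Literature.MathematicalPhysics.QuantumFieldTheory.Balaban1983to89.B9BackgroundsKLevelV1R
import Literature.MathematicalPhysics.QuantumFieldTheory.Balaban1983to89.Node00.OpsYSectDCoords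
import Literature.MathematicalPhysics.QuantumFieldTheory.Balaban1983to89.Node00.OpsYRecordV4P
import Literature.MathematicalPhysics.QuantumFieldTheory.Balaban1983to89.Node00.OpsYSectEPrintUnits

/-!
# `Balaban1983to89.B9Eq3136HstarJAtPinsLetterFamily` — [B9] p. 422, the sentence between (3.136) and (3.137) *«From the regularity condition (3.36) and the
# inequality (3.133) we have the estimate |(H\*J)(b)| ≦ O(1)Mα₀(Lʲη)⁻³ for b ∈ Λ_j»* AT THE PINS OF THE RECORD, FOR AN ARBITRARY LETTER FAMILY `O` (the
# generic-letter, class-parametric Literature edition of seat n06-w8's `…N06HstarJAtPinsWPhys[R].hHJ_of_transpose_schemas_w[R]`), ITS PRINT-UNIT FACE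
# `η^{d+1}·‖(O(U)†J(U))(c)‖ ≦ const` (the currency of the 𝒥-row (b†) of the (3.24) doors), AND THE INSTANCE AT PRINT's `H₁(U)` (3.129) FED `G′_phys`

T. Bałaban, *Propagators for lattice gauge theories in a background field*, Commun. Math. Phys. **99** (1985) 389–434 [`Balaban1985BackgroundPropagators`, "B9"]:
p. 422 (the sentence between (3.136) and (3.137)), (3.133) p. 422, (3.129) p. 421 (`H₁ = G₁Q*(QG₁Q*)⁻¹`), (3.36) p. 396, (3.13) p. 392 and (3.156) p. 428 (the
measure factor `η^{d+1}` of the pairings; `⟨D̃⁽²⁾B, J⟩`); [4] = T. Bałaban, *Propagators and renormalization transformations for lattice gauge theories. II*,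
Commun. Math. Phys. **96** (1984) 223–250 [`Balaban1984PropagatorsII`]: (2.51) p. 232, Lemma 2.1 (2.60)–(2.61) pp. 233–234.

statement-level companion of published sources with citation tags; every declaration here is a theorem; nothing here is a claim about the
Yang–Mills mass gap

WHY THIS FILE (cell `pub-ymgap`, seat `dag-n08-d` gen 42, INTENT-103).  The (3.24) star doors of node N08 at NODE 00's v4P letters (`…PrecisionDoorRecordV4PAdjCurrent`
§2–§3, p709207) display the 𝒥-ROW INPUT (b†) `∀ z, S z → η^{d+1}·‖(H₁(U)†J(U))(z)‖ ≤ j₁` for PRINT's `H₁(U) = H1Y … (GpPhysY …) (𝔯 x).Δ2 U` — node N06's (3.136) content.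
Seat n06-w8 (WIDTH-209 N06) typed that content for `H = HDY … (GpY …)`: Literature `B9Eq3136HstarJBound` §2∕§5 (GENERIC in the letter `H`) and the at-pins wrappers
`Summits/…/BalabanUVNodesN06HstarJAtPinsWPhys[R].hHJ_of_transpose_schemas_w[R]` (SPECIFIC to `HDY … (GpY …)`, and Summits-side, so no Literature door can import them).
THIS FILE is the at-pins wrapper for an ARBITRARY letter family `O x U : (IBondY → M_N(ℂ)) →ₗ[ℂ] (FBondY → M_N(ℂ))` at def-Y's class-parametric carrier
`bg9YR (M_N(ℂ)) SU(N) R₁ R₂` (`c` free) — n06-w8's statement and proof VERBATIM with `HDY x.toKIdx (parSymY …) (parBY …) (GpY … (parSymY …)) U ↦ O x U` — followed by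
the print-unit face and the `H₁`-at-`G′_phys` instance the doors read.
* §1 units of the record: `etaBY_le_geo9Y_len` (`η ≤ (Lʲη)_c`; Literature twin of n06-w8's Summits `etaBY_le_len`), `geo9Y_len_le_one` (`(Lʲη)_c ≤ 1`, `j ≤ k`),
  `etaBY_le_one`, `etaDY_eq_etaBY_pow` (`η_D := etaDY x = η^{d+1}`, from the member's `c_f = Lᵏ`), `etaDY_mul_inv_len_cube_le_one` (`η^{d+1}·((Lʲη)_c³)⁻¹ ≤ 1` once
  `3 ≤ d+1`), `etaDY_mul_blockCount_mul_inv_len_cube_le_one` (the same with the block-count weight `((Lʲη)_c∕η)^{d+1}` in between: `= (Lʲη)_c^{d+1−3} ≤ 1`).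
* §2 ★★ `norm_trAdjY_JY_le_of_transpose_schemas_wR` — n06-w8's `hHJ_of_transpose_schemas_wR` for the letter family `O`: above ONE threshold and in the regime
  `(bg9YR … R₁ R₂ x).Reg335 c α₀ U → Reg336 …`, `‖(O(U)†J(U))(c)‖ ≤ t_{HJ}·(M_xα₀)·(W_T x c·((Lʲη)_c³)⁻¹)` from the WEIGHTED TRANSPOSE SCHEMA `hOT` (a counting-transpose
  `𝔗 x U` of n06-d's model `HcoK … (O x) U` with the [4]-(2.51) majorant `B_T·W_T(c)·e^{−δ_T d}` from the fine carrier (blocks `bI x`) to the coarse one), r06's bond-local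
  regularity datum at every fine bond at the pin scale (`hreg`, constant `c_J·(M_xα₀)`), the direction-blind pin `hbI0`, the rate budget `α_F(1−2α)δ₀ + ρ_R ≤ δ_T` and
  ONE constant `t_{HJ} ≥ N𝔟²·(10⁴(d+1)c_J)·((d+1)·#κ·B_T)·(ℓ+1)³·rowConst261 geo9Y ρ_R`.
* §3 ★★ `etaDY_mul_norm_trAdjY_JY_le_of_transpose_schemas_wR` — THE PRINT-UNIT FACE: under a DISPLAYED weight law `∀ x c, η^{d+1}·(W_T x c·((Lʲη)_c³)⁻¹) ≤ w₁` the bound is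
  `η^{d+1}·‖(O(U)†J(U))(c)‖ ≤ t_{HJ}·a·w₁`, UNIFORM in the coarse bond `c` and in the member — the currency of (b†); its two law-free instances are §5's
  `etaDY_mul_norm_trAdjY_H1Y_JY_le_of_transpose_schemas_w1` (`W_T ≡ 1`, law by §1, `3 ≤ d+1`) and `…_blockCount` (`W_T = ((Lʲη)_c∕η)^{d+1}`, law by §1) (v1.1).
* §4 ★★ `etaDY_mul_norm_trAdjY_H1Y_JY_le_of_transpose_schemas_wR` — §3 at `O x := H1Y x.toKIdx (parSymY …) (parBY …) (GpPhysY … (parSymY …)) (𝔯 x).Δ2` for a residual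
  letter family `𝔯 : ResY N θ M⋆` — PRINT's `H₁(U)` (3.129) with the Sect. D composites fed `G′_phys` (def-Y `Node00.OpsYRecordV4P`; `lettersYOfRecordV4P_H₁`: it IS the
  record letter `(lettersYOfRecordV4P N θ M⋆ 𝔯 x).H₁`, the object of the N06 certificate's pin `hH1m12`), i.e. the (b†) row of the doors BY NAME from N06-species schemas.
* §6 (v1.2) ★★ `etaDY_mul_norm_trAdjY_JY_le_of_transpose_schemas_wR_on` ∕ `…_H1Y_…_wR_on` — §3 ∕ §4 with the weight law asked, and the bound concluded, ONLY ON A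
  DISPLAYED SUPPORT `S x c` of coarse bonds (the (b†) consumer needs it on the output support of `D̃⁽²⁾`, print p. 427 «restricted to unit blocks»); ★
  `etaDY_mul_classWeight_mul_inv_len_cube_eq` ∕ `…_of_len_eq_one` — the law value of the CLASS weight `K·n_c·(Lʲη)_c⁻²` (what F11 §2 produces from a (3.132)-species
  class letter) is `K·(Lʲη)_c^{(d+1)−5}`: NOT uniformly bounded over all `c` at `d+1 = 4`, and `= K` on unit blocks.
HONEST SCOPE.  Kernel bookkeeping BY NAME over n06-w8's `B9Eq3136HstarJBound` (`sum_fiber_kernel_le_of_transposePair`, `norm_trAdjY_JY_le_of_cols_regularAt`,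
`norm_apply_deltaY_le_sum_basis`, `colConst_eq`), r06's (3.36) theorem inside it, the p21∕n06-k member facts (`lemma21Pack_geo9Y`, `rowSum261_geo9Y`,
`rowConst261_spec_of_rowSum261`, `scaleTransfer_len_rpow`) and def-Y's dictionary; (3.133) — as the weighted transpose schema `hOT` — and the cube covering `hreg`
stay DISPLAYED (the latter is a theorem at print's class, n06-w8's `B9Eq336RegularAtAllBondsP.regularAt_pinScale_of_regYP336`, consumed by the doors, not here);
nothing of [B9] ∕ [4] asserted; count-neutral; N06 ∕ N08 NOT discharged; one finite 𝕋^{d+1} programme — nothing continuum ∕ ℝ⁴ ∕ OS ∕ mass gap ∕ Clay.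
No `sorry`, no `def`, no `instance`, no `notation`.  Relatives not restated: n06-w8's Summits wrappers are the instance `O x := HDY … (GpY …)` of §2 (not re-derived here).
-/

noncomputable section

namespace Literature.MathematicalPhysics.QuantumFieldTheory.Balaban1983to89.B9Eq3136HstarJAtPinsLetterFamily

open Node00 (CfgY FBondY IBondY SiteParY BondParY SiteOpY BondOpY GpY GpPhysY parSymY parBY trDualMatY trAdjY JY Stage3Params ResY etaBY etaS etaDY deltaY
  H1Y lettersYOfRecordV4P)
open B6KLevelCensusIndexV1 (KIdx)
open B6Ineq2142KLevelV1 (β lvl lvl_le beta_level)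
open B9Thm34Ext (toB6)
open B6RandomWalkHom (HasMajorantHom)
open B9Thm37Glue (IsTransposePair)
open B9RWSumsDefinitePins (PinPrims)
open B9RWSums347DefiniteFaces (lemma21Pack_geo9Y)
open B9RowSum261DefiniteFaces (rowConst261 rowConst261_nonneg rowConst261_spec_of_rowSum261)
open B9RWSums346Schur (scaleTransfer_len_rpow)
open B9PinMembersKLevelV1 (MemberY geo9Y bg9Y)
open B9GeoLemma21KLevelV1 (geo9Y_len_pos rowSum261_geo9Y)
open B9GeoNormsKLevelV1 (geo9K_dist_nonneg)
open B7Prop2SpecialUnitary (specialUnitaryUnits)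
open B9CoReadingCoords (XBK)
open B9CoReadingCoordsH (XHK HcoK)
open B9CoReadingCoordsTranspose (TrIdx trBasis)
open B9Thm39ReadingCoords (cR39 basisBound39 coordBound39)
open Node00.OpsYSectDCoords (cR39_trBasis_pos)
open B9Eq336CurrentBound (RegularAt)
open B9BackgroundsKLevelV1 (shiftsV1)
open B6GlobalChartV1 (PV)
open B9Ineq349SiteComposite (lenB lenB_eq etaS_pos)
open B9Ineq349SiteFromBlocks (geo9Y_len_eq_lenB etaS_eq_abs_cf_inv)
open B9Eq3136HstarJBound (norm_trAdjY_JY_le_of_cols_regularAt sum_fiber_kernel_le_of_transposePair colConst_eq norm_apply_deltaY_le_sum_basis)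
open B9BackgroundsKLevelV1R (RegFamY bg9YR)
open scoped Matrix.Norms.L2Operator

variable {N : ℕ} {θ : Stage3Params} {Mstar : ℕ}

/-! ## §1 Units of the record: `η ≤ (Lʲη)_c ≤ 1`, `η_D = η^{d+1}`, and the two weight laws -/

section Units

/-- every block scale of the record geometry is at least the lattice spacing: `η = |c_f|⁻¹ ≤ L^{j(c)}·η = (geo9Y x).len c` (Literature twin of n06-w8's Summits
`…N06HstarJAtPinsPhys.etaBY_le_len`, same proof). [cite: Balaban1985BackgroundPropagators, (3.41) p.397 («Lʲη»), p.389 (T_η), bookkeeping] -/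
theorem etaBY_le_geo9Y_len (x : MemberY θ.d₆ θ.ℓ₆ θ.hd' θ.hL' θ.b₀ θ.b₁ Mstar) (c : (geo9Y x).Site) : etaBY x.toKIdx ≤ (geo9Y x).len c := by
  rw [geo9Y_len_eq_lenB, lenB_eq]
  have hη : etaBY x.toKIdx = etaS x.toKIdx := by rw [etaS_eq_abs_cf_inv]; rfl
  rw [hη]
  have h1 : (1 : ℝ) ≤ ((θ.ℓ₆ : ℝ) + 1) ^ (β x.hN x.D x.hk c).1.1 := one_le_pow₀ (by linarith [(Nat.cast_nonneg θ.ℓ₆ : (0 : ℝ) ≤ θ.ℓ₆)])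
  have hη0 : 0 < etaS x.toKIdx := etaS_pos _
  nlinarith

/-- `η = |c_f|⁻¹ = (Lᵏ)⁻¹` at a member (`c_f = Lᵏ`). [cite: Balaban1984PropagatorsII, (2.1) p.224 («η = L^{−k}»), bookkeeping] -/
theorem etaBY_eq_inv_pow (x : MemberY θ.d₆ θ.ℓ₆ θ.hd' θ.hL' θ.b₀ θ.b₁ Mstar) : etaBY x.toKIdx = ((((θ.ℓ₆ + 1 : ℕ) : ℝ)) ^ x.k)⁻¹ := by
  show |x.cf|⁻¹ = _
  rw [x.hcfk, abs_of_nonneg (by positivity)]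

/-- `η ≤ 1`. [cite: Balaban1984PropagatorsII, (2.1) p.224 («η = L^{−k}»), bookkeeping] -/
theorem etaBY_le_one (x : MemberY θ.d₆ θ.ℓ₆ θ.hd' θ.hL' θ.b₀ θ.b₁ Mstar) : etaBY x.toKIdx ≤ 1 := by
  rw [etaBY_eq_inv_pow]
  exact inv_le_one_of_one_le₀ (one_le_pow₀ (by exact_mod_cast Nat.succ_le_succ (Nat.zero_le _)))

/-- `0 < η`. [cite: Balaban1984PropagatorsII, (2.1) p.224, bookkeeping] -/
theorem etaBY_pos' (x : MemberY θ.d₆ θ.ℓ₆ θ.hd' θ.hL' θ.b₀ θ.b₁ Mstar) : 0 < etaBY x.toKIdx := by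
  rw [etaBY_eq_inv_pow]
  exact inv_pos.mpr (pow_pos (by exact_mod_cast Nat.succ_pos _) _)

/-- ★ **print's measure factor is `η^{d+1}`**: `etaDY x = (etaBY x.toKIdx)^{d+1}` (def-Y's `etaDY x = ((Lᵏ)⁻¹)^{d+1}` and the member's `c_f = Lᵏ`; the factor
`(Lʲη)^{d+1}` displayed in (3.136)). [cite: Balaban1985BackgroundPropagators, (3.136) p.422, p.389 (T_η, η = L^{−k}), dictionary] -/
theorem etaDY_eq_etaBY_pow (x : MemberY θ.d₆ θ.ℓ₆ θ.hd' θ.hL' θ.b₀ θ.b₁ Mstar) : etaDY x = etaBY x.toKIdx ^ (θ.d₆ + 1) := by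
  rw [etaBY_eq_inv_pow]; rfl

/-- every block scale of the record geometry is at most the unit scale: `(Lʲη)_c = L^{j(c)}·L^{−k} ≤ 1` (`j(c) ≤ k`; bookkeeping `η = L^{−k}`, so `Lᵏη = 1`).
[cite: Balaban1985BackgroundPropagators, (3.41) p.397 («Lʲη»), p.389 (T_η), bookkeeping] -/
theorem geo9Y_len_le_one (x : MemberY θ.d₆ θ.ℓ₆ θ.hd' θ.hL' θ.b₀ θ.b₁ Mstar) (c : (geo9Y x).Site) : (geo9Y x).len c ≤ 1 := by
  rw [geo9Y_len_eq_lenB, lenB_eq]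
  have hη : etaS x.toKIdx = ((((θ.ℓ₆ + 1 : ℕ) : ℝ)) ^ x.k)⁻¹ := by rw [etaS_eq_abs_cf_inv, x.hcfk, abs_of_nonneg (by positivity)]
  rw [hη]
  have hL1 : (1 : ℝ) ≤ ((θ.ℓ₆ : ℝ) + 1) := by linarith [(Nat.cast_nonneg θ.ℓ₆ : (0 : ℝ) ≤ θ.ℓ₆)]
  have hjk : (β x.hN x.D x.hk c).1.1 ≤ x.k := by
    rw [beta_level x.hN x.D x.hk (le_trans one_le_two x.hk2)]; exact lvl_le x.hN x.D x.hk c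
  have hpow : ((θ.ℓ₆ : ℝ) + 1) ^ (β x.hN x.D x.hk c).1.1 ≤ ((θ.ℓ₆ : ℝ) + 1) ^ x.k := pow_le_pow_right₀ hL1 hjk
  have hcast : ((((θ.ℓ₆ + 1 : ℕ) : ℝ)) ^ x.k) = ((θ.ℓ₆ : ℝ) + 1) ^ x.k := by push_cast; ring
  rw [hcast]
  have hpos : (0 : ℝ) < ((θ.ℓ₆ : ℝ) + 1) ^ x.k := by positivity
  rw [← div_eq_mul_inv, div_le_one hpos]
  exact hpow

/-- ★ **THE UNWEIGHTED LAW**: `η^{d+1}·((Lʲη)_c³)⁻¹ ≤ 1` once `3 ≤ d+1` (`η^{d+1} ≤ η³ ≤ (Lʲη)_c³`). [cite: Balaban1985BackgroundPropagators, (3.13) p.392, (3.41) p.397, bookkeeping] -/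
theorem etaDY_mul_inv_len_cube_le_one (hD : 3 ≤ θ.d₆ + 1) (x : MemberY θ.d₆ θ.ℓ₆ θ.hd' θ.hL' θ.b₀ θ.b₁ Mstar) (c : (geo9Y x).Site) :
    etaDY x * ((geo9Y x).len c ^ 3)⁻¹ ≤ 1 := by
  have hη0 := etaBY_pos' x
  have hη1 := etaBY_le_one x
  have hlen := etaBY_le_geo9Y_len x c
  have hlen0 := geo9Y_len_pos x c
  rw [etaDY_eq_etaBY_pow]
  have h1 : etaBY x.toKIdx ^ (θ.d₆ + 1) ≤ etaBY x.toKIdx ^ 3 := pow_le_pow_of_le_one hη0.le hη1 hD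
  have h2 : etaBY x.toKIdx ^ 3 ≤ (geo9Y x).len c ^ 3 := pow_le_pow_left₀ hη0.le hlen 3
  have h3 : 0 < (geo9Y x).len c ^ 3 := pow_pos hlen0 3
  rw [← div_eq_mul_inv, div_le_one h3]
  exact h1.trans h2

/-- ★ **THE BLOCK-COUNT LAW**: with the block-count weight `n_c := ((Lʲη)_c∕η)^{d+1}` (the number of fine sites of a block of scale `j(c)`) in between,
`η^{d+1}·(n_c·((Lʲη)_c³)⁻¹) = (Lʲη)_c^{d+1}·((Lʲη)_c³)⁻¹ ≤ 1` once `3 ≤ d+1` (`(Lʲη)_c ≤ 1`). [cite: Balaban1985BackgroundPropagators, (3.13) p.392, (3.16) p.393, (3.41) p.397, bookkeeping] -/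
theorem etaDY_mul_blockCount_mul_inv_len_cube_le_one (hD : 3 ≤ θ.d₆ + 1) (x : MemberY θ.d₆ θ.ℓ₆ θ.hd' θ.hL' θ.b₀ θ.b₁ Mstar) (c : (geo9Y x).Site) :
    etaDY x * (((geo9Y x).len c / etaBY x.toKIdx) ^ (θ.d₆ + 1) * ((geo9Y x).len c ^ 3)⁻¹) ≤ 1 := by
  have hη0 := etaBY_pos' x
  have hlen0 := geo9Y_len_pos x c
  have hlen1 := geo9Y_len_le_one x c
  rw [etaDY_eq_etaBY_pow, div_pow, ← mul_assoc, mul_div_assoc', mul_comm (etaBY x.toKIdx ^ (θ.d₆ + 1)), mul_div_assoc,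
    div_self (pow_ne_zero _ hη0.ne'), mul_one]
  have h1 : (geo9Y x).len c ^ (θ.d₆ + 1) ≤ (geo9Y x).len c ^ 3 := pow_le_pow_of_le_one hlen0.le hlen1 hD
  have h3 : 0 < (geo9Y x).len c ^ 3 := pow_pos hlen0 3
  rw [← div_eq_mul_inv, div_le_one h3]
  exact h1

end Units

/-! ## §2 The `(O(U)†J(U))(c)` letter at the pins from the WEIGHTED transpose schema, for an arbitrary letter family `O` (n06-w8's theorem, generic letter) -/

section Letter

variable [NeZero N]
variable [∀ x : MemberY θ.d₆ θ.ℓ₆ θ.hd' θ.hL' θ.b₀ θ.b₁ Mstar, Fintype (geo9Y x).Site]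

/-- ★★ **THE `(H\*J)` LETTER AT THE PINS FOR AN ARBITRARY LETTER FAMILY `O`, FROM THE WEIGHTED TRANSPOSE SCHEMA** (n06-w8's
`…N06HstarJAtPinsWPhysR.hHJ_of_transpose_schemas_wR` VERBATIM with `HDY x.toKIdx (parSymY …) (parBY …) (GpY … (parSymY …)) U ↦ O x U`): at def-Y's class-parametric
carrier `bg9YR (M_N(ℂ)) SU(N) R₁ R₂` (`c` free), above ONE threshold and in the regime, `‖(O(U)†J(U))(c)‖ ≤ t_{HJ}·(M_xα₀)·(W_T x c·((Lʲη)_c³)⁻¹)` for def-Y's genuine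
current `J(U) = JY x.toKIdx U` and the `τ`-transpose `O(U)† = trAdjY (trDualMatY N) (O x U)`, from: the weighted transpose schema `hOT` (a counting-transpose `𝔗 x U` of
the model `HcoK … (O x) U` with the [4]-(2.51) majorant `B_T·W_T(c)·e^{−δ_T d}`), regularity at every fine bond at the pin scale (`hreg`, r06's `RegularAt`, constant
`c_J·(M_xα₀) ≤ 1`), the direction-blind pin `hbI0`, the member facts (the p. 398 transfer of `(Lʲη)⁻³` at `((1−2α)δ₀, α_F)`, [4] (2.61) at `ρ_R`), the budget
`α_F(1−2α)δ₀ + ρ_R ≤ δ_T` and ONE constant `t_{HJ}`.  No class fact is read (`R₁`, `R₂` arbitrary).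
[cite: Balaban1985BackgroundPropagators, p.422 (the sentence between (3.136) and (3.137)), (3.133) p.422, (3.36) p.396, p.398; Balaban1984PropagatorsII, (2.51) p.232, Lemma 2.1 (2.60)–(2.61) pp.233–234] -/
theorem norm_trAdjY_JY_le_of_transpose_schemas_wR (q : PinPrims) (hq : q.OK) (H : MemberY θ.d₆ θ.ℓ₆ θ.hd' θ.hL' θ.b₀ θ.b₁ Mstar → Prop)
    (R₁ R₂ : RegFamY θ.d₆ θ.ℓ₆ θ.hd' θ.hL' θ.b₀ θ.b₁ Mstar (Matrix (Fin N) (Fin N) ℂ)) (c : ℝ)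
    (O : ∀ x : MemberY θ.d₆ θ.ℓ₆ θ.hd' θ.hL' θ.b₀ θ.b₁ Mstar,
      CfgY (Matrix (Fin N) (Fin N) ℂ) x.toKIdx → (IBondY x.toKIdx → Matrix (Fin N) (Fin N) ℂ) →ₗ[ℂ] (FBondY x.toKIdx → Matrix (Fin N) (Fin N) ℂ))
    (bI : ∀ x : MemberY θ.d₆ θ.ℓ₆ θ.hd' θ.hL' θ.b₀ θ.b₁ Mstar, FBondY x.toKIdx → IBondY x.toKIdx)
    (hbI0 : ∀ (x : MemberY θ.d₆ θ.ℓ₆ θ.hd' θ.hL' θ.b₀ θ.b₁ Mstar) (f : FBondY x.toKIdx), bI x f = bI x ⟨f.src, 0⟩)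
    (𝔗 : ∀ x : MemberY θ.d₆ θ.ℓ₆ θ.hd' θ.hL' θ.b₀ θ.b₁ Mstar, (bg9Y (Matrix (Fin N) (Fin N) ℂ) (specialUnitaryUnits (Fin N)) x).Cfg →
      (XBK (TrIdx N) x.toKIdx → ℝ) →ₗ[ℝ] (XHK (TrIdx N) x.toKIdx → ℝ))
    (WT : ∀ x : MemberY θ.d₆ θ.ℓ₆ θ.hd' θ.hL' θ.b₀ θ.b₁ Mstar, IBondY x.toKIdx → ℝ) (hWT : ∀ x c, 0 ≤ WT x c)
    (cJ BT δT ρR tHJ M a : ℝ) (hcJ : 0 ≤ cJ) (hBT : 0 ≤ BT) (hρR : 0 < ρR) (hM : 0 < M) (ha1 : cJ * a ≤ 1)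
    (hδT : q.αF * ((1 - 2 * q.α) * q.δ₀) + ρR ≤ δT)
    (htHJ : N * basisBound39 (trBasis N) ^ 2 * (10 ^ 4 * ((θ.d₆ : ℝ) + 1) * cJ) * (((θ.d₆ : ℝ) + 1) * Fintype.card (TrIdx N) * BT) *
      ((((θ.ℓ₆ + 1 : ℕ) : ℝ) ^ 3) * rowConst261 (geo9Y (d := θ.d₆) (ℓ := θ.ℓ₆) (hd := θ.hd') (hL := θ.hL') (b₀ := θ.b₀) (b₁ := θ.b₁) (Mstar := Mstar)) ρR) ≤ tHJ)
    (hOT : ∀ x : MemberY θ.d₆ θ.ℓ₆ θ.hd' θ.hL' θ.b₀ θ.b₁ Mstar, M ≤ (geo9Y x).M → ∀ α₀ : ℝ, 0 < α₀ → (geo9Y x).M * α₀ ≤ a →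
      ∀ U : (bg9Y (Matrix (Fin N) (Fin N) ℂ) (specialUnitaryUnits (Fin N)) x).Cfg,
        (bg9YR (Matrix (Fin N) (Fin N) ℂ) (specialUnitaryUnits (Fin N)) R₁ R₂ x).Reg335 c α₀ U →
        (bg9YR (Matrix (Fin N) (Fin N) ℂ) (specialUnitaryUnits (Fin N)) R₁ R₂ x).Reg336 c α₀ U →
          IsTransposePair (HcoK x.toKIdx (trBasis N) (bg9Y (Matrix (Fin N) (Fin N) ℂ) (specialUnitaryUnits (Fin N)) x) (fun U => U) (O x) U) (𝔗 x U) ∧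
            HasMajorantHom (g := toB6 (geo9Y x) 1 (H x)) (fun p : XBK (TrIdx N) x.toKIdx => bI x p.1) (fun p : XHK (TrIdx N) x.toKIdx => p.1) (𝔗 x U)
              (fun c y' => BT * WT x c * Real.exp (-(δT * (geo9Y x).dist c y'))))
    (hreg : ∀ x : MemberY θ.d₆ θ.ℓ₆ θ.hd' θ.hL' θ.b₀ θ.b₁ Mstar, M ≤ (geo9Y x).M → ∀ α₀ : ℝ, 0 < α₀ → (geo9Y x).M * α₀ ≤ a →
      ∀ U : (bg9Y (Matrix (Fin N) (Fin N) ℂ) (specialUnitaryUnits (Fin N)) x).Cfg,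
        (bg9YR (Matrix (Fin N) (Fin N) ℂ) (specialUnitaryUnits (Fin N)) R₁ R₂ x).Reg335 c α₀ U →
        (bg9YR (Matrix (Fin N) (Fin N) ℂ) (specialUnitaryUnits (Fin N)) R₁ R₂ x).Reg336 c α₀ U →
          ∀ μ s, RegularAt (shiftsV1 (PV θ.d₆ θ.ℓ₆ x.toKIdx.m x.toKIdx.K θ.hd' θ.hL')) U (etaBY x.toKIdx)
            (cJ * ((geo9Y x).M * α₀)) ((geo9Y x).len (bI x ⟨s, 0⟩)) μ s) :
    ∃ MH : ℝ, ∀ x : MemberY θ.d₆ θ.ℓ₆ θ.hd' θ.hL' θ.b₀ θ.b₁ Mstar, MH ≤ (geo9Y x).M → M ≤ (geo9Y x).M → ∀ α₀ : ℝ, 0 < α₀ → (geo9Y x).M * α₀ ≤ a →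
      ∀ U : (bg9Y (Matrix (Fin N) (Fin N) ℂ) (specialUnitaryUnits (Fin N)) x).Cfg,
        (bg9YR (Matrix (Fin N) (Fin N) ℂ) (specialUnitaryUnits (Fin N)) R₁ R₂ x).Reg335 c α₀ U →
        (bg9YR (Matrix (Fin N) (Fin N) ℂ) (specialUnitaryUnits (Fin N)) R₁ R₂ x).Reg336 c α₀ U →
          ∀ c : IBondY x.toKIdx,
            ‖trAdjY (trDualMatY N) (O x U) (JY x.toKIdx U) c‖ ≤ tHJ * ((geo9Y x).M * α₀) * (WT x c * ((geo9Y x).len c ^ 3)⁻¹) := by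
  -- member facts: the p. 398 transfer at ((1 − 2α)δ₀, α_F) and [4] (2.61) at the rate ρ_R, above ONE threshold each
  obtain ⟨Mth, -, hfacts, -⟩ :=
    lemma21Pack_geo9Y (d := θ.d₆) (ℓ := θ.ℓ₆) (hd := θ.hd') (hL := θ.hL') (b₀ := θ.b₀) (b₁ := θ.b₁) (Mstar := Mstar) H hq.α_pos hq.α_lt
      hq.δ₀_pos hq.αF_pos (by linarith only [hq.αF_lt])
  obtain ⟨MLσ, hrowc⟩ := rowConst261_spec_of_rowSum261
    (rowSum261_geo9Y (d := θ.d₆) (ℓ := θ.ℓ₆) (hd := θ.hd') (hL := θ.hL') (b₀ := θ.b₀) (b₁ := θ.b₁) (Mstar := Mstar)) hρR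
  have hN : 0 < N := Nat.pos_of_ne_zero (NeZero.ne N)
  have hc0 : 0 < cR39 (trBasis N) := cR39_trBasis_pos hN
  refine ⟨max Mth MLσ, fun x hMx hMM α₀ hα ha U hU hU' c => ?_⟩
  have hF := hfacts x ((le_max_left _ _).trans hMx)
  have hθ : 0 ≤ (geo9Y x).M * α₀ := mul_nonneg (hM.le.trans hMM) hα.le
  -- print's `O(1)Mα₀ ≤ 1`
  have hC0 : 0 ≤ cJ * ((geo9Y x).M * α₀) := mul_nonneg hcJ hθ
  have hC1 : cJ * ((geo9Y x).M * α₀) ≤ 1 := (mul_le_mul_of_nonneg_left ha hcJ).trans ha1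
  -- p. 398 transfer of `(Lʲη)⁻³` at constant `L³ ≤ (ℓ+1)³`
  have hL1 : 1 ≤ (geo9Y x).L := hF.one_le_L
  have hLle : (geo9Y x).L ^ |(-3 : ℝ)| ≤ ((θ.ℓ₆ + 1 : ℕ) : ℝ) ^ 3 := by
    rw [show |(-3 : ℝ)| = (3 : ℕ) by norm_num, Real.rpow_natCast]
    exact pow_le_pow_left₀ (zero_le_one.trans hL1) hF.L_le 3
  have htr : ∀ y y' : (geo9Y x).Site, Real.exp (-(q.αF * ((1 - 2 * q.α) * q.δ₀) * (geo9Y x).dist y y')) * ((geo9Y x).len y' ^ 3)⁻¹ ≤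
      ((θ.ℓ₆ + 1 : ℕ) : ℝ) ^ 3 * ((geo9Y x).len y ^ 3)⁻¹ := by
    intro y y'
    have hst := scaleTransfer_len_rpow hF (-3) (by norm_num) y y'
    have hy := geo9Y_len_pos x y
    have hy' := geo9Y_len_pos x y'
    have e1 : ((geo9Y x).len y' ^ 3)⁻¹ = (geo9Y x).len y' ^ (-3 : ℝ) := by
      rw [show (-3 : ℝ) = -((3 : ℕ) : ℝ) by norm_num, Real.rpow_neg hy'.le, Real.rpow_natCast]
    have e2 : ((geo9Y x).len y ^ 3)⁻¹ = (geo9Y x).len y ^ (-3 : ℝ) := by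
      rw [show (-3 : ℝ) = -((3 : ℕ) : ℝ) by norm_num, Real.rpow_neg hy.le, Real.rpow_natCast]
    rw [e1, e2]
    exact hst.trans (mul_le_mul_of_nonneg_right hLle (Real.rpow_nonneg hy.le _))
  -- [4] (2.61) row sum at the rate ρ_R
  have hR : ∑ y' : (geo9Y x).Site, Real.exp (-(ρR * (geo9Y x).dist c y')) ≤
      rowConst261 (geo9Y (d := θ.d₆) (ℓ := θ.ℓ₆) (hd := θ.hd') (hL := θ.hL') (b₀ := θ.b₀) (b₁ := θ.b₁) (Mstar := Mstar)) ρR := by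
    exact hrowc x ((le_max_right _ _).trans hMx) c
  obtain ⟨hT, hK'⟩ := hOT x hMM α₀ hα ha U hU hU'
  -- the pointwise kernel letter of `O(U)` from the basis directions (F7 §2), then F7 §5 at `B_H := (d+1)·#κ·B_T·W_T(c)`
  have hKH0 : ∀ z : FBondY x.toKIdx, 0 ≤ coordBound39 (trBasis N) * ∑ k', ‖O x U (deltaY c (trBasis N k')) z‖ := fun z =>
    mul_nonneg (norm_nonneg _) (Finset.sum_nonneg fun _ _ => norm_nonneg _)
  have hH : ∀ (a : Matrix (Fin N) (Fin N) ℂ) (z : FBondY x.toKIdx),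
      ‖O x U (deltaY c a) z‖ ≤ (coordBound39 (trBasis N) * ∑ k', ‖O x U (deltaY c (trBasis N k')) z‖) * ‖a‖ :=
    fun a z => norm_apply_deltaY_le_sum_basis x.toKIdx (trBasis N) (O x) U a c z
  have hmain := norm_trAdjY_JY_le_of_cols_regularAt x.toKIdx (g := geo9Y x) (O x U) (bI x) (hbI0 x) (fun c => c) (etaBY_le_geo9Y_len x)
    hC0 hC1 U (hreg x hMM α₀ hα ha U hU hU') c (BH := ((θ.d₆ : ℝ) + 1) * Fintype.card (TrIdx N) * BT * WT x c) (δH := δT) hKH0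
    (mul_nonneg (mul_nonneg (mul_nonneg (by positivity) (Nat.cast_nonneg _)) hBT) (hWT x c)) hH
    (fun y' => by
      -- the column-block letter from the WEIGHTED transpose majorant: F7 §2 at the kernel `B_T·W_T(c)·e^{−δ_T d}` (the weight is constant in the
      -- summation variable), constant reduced by `colConst_eq`
      have h := sum_fiber_kernel_le_of_transposePair (R₀ := 1) (H₀ := H x) x.toKIdx (trBasis N)
        (bg9Y (Matrix (Fin N) (Fin N) ℂ) (specialUnitaryUnits (Fin N)) x) (fun U => U) (O x) (g := geo9Y x) (bI x) (fun c => c) U hc0 hT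
        (fun a _ => mul_nonneg (mul_nonneg hBT (hWT x a)) (Real.exp_nonneg _)) hK' c y'
      rw [colConst_eq (trBasis N) hc0] at h
      refine h.trans (le_of_eq ?_)
      ring)
    (by positivity) hδT (geo9K_dist_nonneg x.toKIdx) htr hR
  have hw : 0 ≤ WT x c * ((geo9Y x).len c ^ 3)⁻¹ := mul_nonneg (hWT x c) (inv_nonneg.mpr (pow_nonneg (geo9Y_len_pos x c).le 3))
  calc _ ≤ _ := hmain
    _ = (N * basisBound39 (trBasis N) ^ 2 * (10 ^ 4 * ((θ.d₆ : ℝ) + 1) * cJ) * (((θ.d₆ : ℝ) + 1) * Fintype.card (TrIdx N) * BT) *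
          ((((θ.ℓ₆ + 1 : ℕ) : ℝ) ^ 3) *
            rowConst261 (geo9Y (d := θ.d₆) (ℓ := θ.ℓ₆) (hd := θ.hd') (hL := θ.hL') (b₀ := θ.b₀) (b₁ := θ.b₁) (Mstar := Mstar)) ρR)) *
          ((geo9Y x).M * α₀) * (WT x c * ((geo9Y x).len c ^ 3)⁻¹) := by ring
    _ ≤ tHJ * ((geo9Y x).M * α₀) * (WT x c * ((geo9Y x).len c ^ 3)⁻¹) := mul_le_mul_of_nonneg_right (mul_le_mul_of_nonneg_right htHJ hθ) hw

/-! ## §3 The print-unit face: `η^{d+1}·‖(O(U)†J(U))(c)‖ ≤ t_{HJ}·a·w₁`, UNIFORM in the coarse bond (the currency of the doors' 𝒥-row (b†)) -/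

/-- ★★ **THE PRINT-UNIT FACE UNDER A DISPLAYED WEIGHT LAW**: if `∀ x c, η^{d+1}·(W_T x c·((Lʲη)_c³)⁻¹) ≤ w₁`, then above the threshold and in the regime
`η^{d+1}·‖(O(U)†J(U))(c)‖ ≤ t_{HJ}·a·w₁` for EVERY coarse bond `c` (§2, `M_xα₀ ≤ a`, `0 ≤ t_{HJ}` from its lower bound).  The weight laws of record are §1's
`etaDY_mul_inv_len_cube_le_one` (`W_T ≡ 1`) and `etaDY_mul_blockCount_mul_inv_len_cube_le_one` (`W_T = n_c`), both with `w₁ = 1`.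
[cite: Balaban1985BackgroundPropagators, p.422 (the sentence between (3.136) and (3.137)), (3.13) p.392, (3.156) p.428, (3.133) p.422, (3.36) p.396; Balaban1984PropagatorsII, (2.51) p.232, Lemma 2.1 (2.60)–(2.61) pp.233–234] -/
theorem etaDY_mul_norm_trAdjY_JY_le_of_transpose_schemas_wR (q : PinPrims) (hq : q.OK) (H : MemberY θ.d₆ θ.ℓ₆ θ.hd' θ.hL' θ.b₀ θ.b₁ Mstar → Prop)
    (R₁ R₂ : RegFamY θ.d₆ θ.ℓ₆ θ.hd' θ.hL' θ.b₀ θ.b₁ Mstar (Matrix (Fin N) (Fin N) ℂ)) (c : ℝ)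
    (O : ∀ x : MemberY θ.d₆ θ.ℓ₆ θ.hd' θ.hL' θ.b₀ θ.b₁ Mstar,
      CfgY (Matrix (Fin N) (Fin N) ℂ) x.toKIdx → (IBondY x.toKIdx → Matrix (Fin N) (Fin N) ℂ) →ₗ[ℂ] (FBondY x.toKIdx → Matrix (Fin N) (Fin N) ℂ))
    (bI : ∀ x : MemberY θ.d₆ θ.ℓ₆ θ.hd' θ.hL' θ.b₀ θ.b₁ Mstar, FBondY x.toKIdx → IBondY x.toKIdx)
    (hbI0 : ∀ (x : MemberY θ.d₆ θ.ℓ₆ θ.hd' θ.hL' θ.b₀ θ.b₁ Mstar) (f : FBondY x.toKIdx), bI x f = bI x ⟨f.src, 0⟩)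
    (𝔗 : ∀ x : MemberY θ.d₆ θ.ℓ₆ θ.hd' θ.hL' θ.b₀ θ.b₁ Mstar, (bg9Y (Matrix (Fin N) (Fin N) ℂ) (specialUnitaryUnits (Fin N)) x).Cfg →
      (XBK (TrIdx N) x.toKIdx → ℝ) →ₗ[ℝ] (XHK (TrIdx N) x.toKIdx → ℝ))
    (WT : ∀ x : MemberY θ.d₆ θ.ℓ₆ θ.hd' θ.hL' θ.b₀ θ.b₁ Mstar, IBondY x.toKIdx → ℝ) (hWT : ∀ x c, 0 ≤ WT x c)
    {w₁ : ℝ} (hWη : ∀ (x : MemberY θ.d₆ θ.ℓ₆ θ.hd' θ.hL' θ.b₀ θ.b₁ Mstar) (c : IBondY x.toKIdx), etaDY x * (WT x c * ((geo9Y x).len c ^ 3)⁻¹) ≤ w₁)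
    (cJ BT δT ρR tHJ M a : ℝ) (hcJ : 0 ≤ cJ) (hBT : 0 ≤ BT) (hρR : 0 < ρR) (hM : 0 < M) (ha1 : cJ * a ≤ 1)
    (hδT : q.αF * ((1 - 2 * q.α) * q.δ₀) + ρR ≤ δT)
    (htHJ : N * basisBound39 (trBasis N) ^ 2 * (10 ^ 4 * ((θ.d₆ : ℝ) + 1) * cJ) * (((θ.d₆ : ℝ) + 1) * Fintype.card (TrIdx N) * BT) *
      ((((θ.ℓ₆ + 1 : ℕ) : ℝ) ^ 3) * rowConst261 (geo9Y (d := θ.d₆) (ℓ := θ.ℓ₆) (hd := θ.hd') (hL := θ.hL') (b₀ := θ.b₀) (b₁ := θ.b₁) (Mstar := Mstar)) ρR) ≤ tHJ)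
    (hOT : ∀ x : MemberY θ.d₆ θ.ℓ₆ θ.hd' θ.hL' θ.b₀ θ.b₁ Mstar, M ≤ (geo9Y x).M → ∀ α₀ : ℝ, 0 < α₀ → (geo9Y x).M * α₀ ≤ a →
      ∀ U : (bg9Y (Matrix (Fin N) (Fin N) ℂ) (specialUnitaryUnits (Fin N)) x).Cfg,
        (bg9YR (Matrix (Fin N) (Fin N) ℂ) (specialUnitaryUnits (Fin N)) R₁ R₂ x).Reg335 c α₀ U →
        (bg9YR (Matrix (Fin N) (Fin N) ℂ) (specialUnitaryUnits (Fin N)) R₁ R₂ x).Reg336 c α₀ U →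
          IsTransposePair (HcoK x.toKIdx (trBasis N) (bg9Y (Matrix (Fin N) (Fin N) ℂ) (specialUnitaryUnits (Fin N)) x) (fun U => U) (O x) U) (𝔗 x U) ∧
            HasMajorantHom (g := toB6 (geo9Y x) 1 (H x)) (fun p : XBK (TrIdx N) x.toKIdx => bI x p.1) (fun p : XHK (TrIdx N) x.toKIdx => p.1) (𝔗 x U)
              (fun c y' => BT * WT x c * Real.exp (-(δT * (geo9Y x).dist c y'))))
    (hreg : ∀ x : MemberY θ.d₆ θ.ℓ₆ θ.hd' θ.hL' θ.b₀ θ.b₁ Mstar, M ≤ (geo9Y x).M → ∀ α₀ : ℝ, 0 < α₀ → (geo9Y x).M * α₀ ≤ a →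
      ∀ U : (bg9Y (Matrix (Fin N) (Fin N) ℂ) (specialUnitaryUnits (Fin N)) x).Cfg,
        (bg9YR (Matrix (Fin N) (Fin N) ℂ) (specialUnitaryUnits (Fin N)) R₁ R₂ x).Reg335 c α₀ U →
        (bg9YR (Matrix (Fin N) (Fin N) ℂ) (specialUnitaryUnits (Fin N)) R₁ R₂ x).Reg336 c α₀ U →
          ∀ μ s, RegularAt (shiftsV1 (PV θ.d₆ θ.ℓ₆ x.toKIdx.m x.toKIdx.K θ.hd' θ.hL')) U (etaBY x.toKIdx)
            (cJ * ((geo9Y x).M * α₀)) ((geo9Y x).len (bI x ⟨s, 0⟩)) μ s) :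
    ∃ MH : ℝ, ∀ x : MemberY θ.d₆ θ.ℓ₆ θ.hd' θ.hL' θ.b₀ θ.b₁ Mstar, MH ≤ (geo9Y x).M → M ≤ (geo9Y x).M → ∀ α₀ : ℝ, 0 < α₀ → (geo9Y x).M * α₀ ≤ a →
      ∀ U : (bg9Y (Matrix (Fin N) (Fin N) ℂ) (specialUnitaryUnits (Fin N)) x).Cfg,
        (bg9YR (Matrix (Fin N) (Fin N) ℂ) (specialUnitaryUnits (Fin N)) R₁ R₂ x).Reg335 c α₀ U →
        (bg9YR (Matrix (Fin N) (Fin N) ℂ) (specialUnitaryUnits (Fin N)) R₁ R₂ x).Reg336 c α₀ U →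
          ∀ c : IBondY x.toKIdx, etaDY x * ‖trAdjY (trDualMatY N) (O x U) (JY x.toKIdx U) c‖ ≤ tHJ * a * w₁ := by
  obtain ⟨MH, hMH⟩ := norm_trAdjY_JY_le_of_transpose_schemas_wR q hq H R₁ R₂ c O bI hbI0 𝔗 WT hWT cJ BT δT ρR tHJ M a hcJ hBT hρR hM ha1 hδT htHJ hOT hreg
  refine ⟨MH, fun x hMx hMM α₀ hα ha U hU hU' c => ?_⟩
  have h := hMH x hMx hMM α₀ hα ha U hU hU' c
  have hη : 0 ≤ etaDY x := (Node00.etaDY_pos x).le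
  have htHJ0 : 0 ≤ tHJ := le_trans (by
    have := rowConst261_nonneg (geo9Y (d := θ.d₆) (ℓ := θ.ℓ₆) (hd := θ.hd') (hL := θ.hL') (b₀ := θ.b₀) (b₁ := θ.b₁) (Mstar := Mstar)) ρR
    positivity) htHJ
  have hθ : 0 ≤ (geo9Y x).M * α₀ := mul_nonneg (hM.le.trans hMM) hα.le
  have hw : 0 ≤ WT x c * ((geo9Y x).len c ^ 3)⁻¹ := mul_nonneg (hWT x c) (inv_nonneg.mpr (pow_nonneg (geo9Y_len_pos x c).le 3))
  calc etaDY x * ‖trAdjY (trDualMatY N) (O x U) (JY x.toKIdx U) c‖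
      ≤ etaDY x * (tHJ * ((geo9Y x).M * α₀) * (WT x c * ((geo9Y x).len c ^ 3)⁻¹)) := mul_le_mul_of_nonneg_left h hη
    _ = tHJ * ((geo9Y x).M * α₀) * (etaDY x * (WT x c * ((geo9Y x).len c ^ 3)⁻¹)) := by ring
    _ ≤ tHJ * a * w₁ := by
        have h1 : tHJ * ((geo9Y x).M * α₀) ≤ tHJ * a := mul_le_mul_of_nonneg_left ha htHJ0
        have h2 : 0 ≤ tHJ * a := le_trans (mul_nonneg htHJ0 hθ) h1
        calc tHJ * ((geo9Y x).M * α₀) * (etaDY x * (WT x c * ((geo9Y x).len c ^ 3)⁻¹))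
            ≤ tHJ * a * (etaDY x * (WT x c * ((geo9Y x).len c ^ 3)⁻¹)) := mul_le_mul_of_nonneg_right h1 (mul_nonneg hη hw)
          _ ≤ tHJ * a * w₁ := mul_le_mul_of_nonneg_left (hWη x c) h2

end Letter

/-! ## §4 The instance at PRINT's `H₁(U) = G₁Q*(QG₁Q*)⁻¹` (3.129) fed `G′_phys` — the object of the doors' 𝒥-row (b†) and of the N06 certificate's pin `hH1m12` -/

section H1

variable [NeZero N]
variable [∀ x : MemberY θ.d₆ θ.ℓ₆ θ.hd' θ.hL' θ.b₀ θ.b₁ Mstar, Fintype (geo9Y x).Site]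

omit [NeZero N] [∀ x : MemberY θ.d₆ θ.ℓ₆ θ.hd' θ.hL' θ.b₀ θ.b₁ Mstar, Fintype (geo9Y x).Site] in
/-- the record's `H₁` letter at the v4P letters IS `H1Y` over the symmetrised tables fed `G′_phys` with the residual `Δ⁽²⁾(U)` (def-Y `OpsYRecordV4P`, `rfl`) — the
object both of the doors' 𝒥-row and of the N06 certificate's pin `hH1m12`. [cite: Balaban1985BackgroundPropagators, (3.129) p.421, bookkeeping] -/
theorem lettersYOfRecordV4P_H₁ (𝔯 : ResY N θ Mstar) (x : MemberY θ.d₆ θ.ℓ₆ θ.hd' θ.hL' θ.b₀ θ.b₁ Mstar) :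
    (lettersYOfRecordV4P N θ Mstar 𝔯 x).H₁ = H1Y x.toKIdx (parSymY x.toKIdx) (parBY x.toKIdx) (GpPhysY x.toKIdx (parSymY x.toKIdx)) (𝔯 x).Δ2 := rfl

/-- ★★ **THE 𝒥-ROW INPUT (b†) OF THE (3.24) DOORS BY NAME FROM N06-SPECIES SCHEMAS**: §3 at `O x := H1Y x.toKIdx (parSymY …) (parBY …) (GpPhysY … (parSymY …)) (𝔯 x).Δ2`
— above ONE threshold and in the regime, `η^{d+1}·‖(H₁(U)†J(U))(c)‖ ≤ t_{HJ}·a·w₁` for EVERY coarse bond `c`, from the weighted transpose schema `hH1T` for the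
model `HcoK … (H1Y … (GpPhysY …) (𝔯 x).Δ2) U`, regularity at every fine bond `hreg`, the pin `hbI0`, the weight law `hWη` and the constants.
[cite: Balaban1985BackgroundPropagators, (3.129) p.421, p.422 (the sentence between (3.136) and (3.137)), (3.156) p.428, (3.133) p.422, (3.36) p.396; Balaban1984PropagatorsII, (2.51) p.232, Lemma 2.1 (2.60)–(2.61) pp.233–234] -/
theorem etaDY_mul_norm_trAdjY_H1Y_JY_le_of_transpose_schemas_wR (q : PinPrims) (hq : q.OK) (H : MemberY θ.d₆ θ.ℓ₆ θ.hd' θ.hL' θ.b₀ θ.b₁ Mstar → Prop)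
    (R₁ R₂ : RegFamY θ.d₆ θ.ℓ₆ θ.hd' θ.hL' θ.b₀ θ.b₁ Mstar (Matrix (Fin N) (Fin N) ℂ)) (c : ℝ) (𝔯 : ResY N θ Mstar)
    (bI : ∀ x : MemberY θ.d₆ θ.ℓ₆ θ.hd' θ.hL' θ.b₀ θ.b₁ Mstar, FBondY x.toKIdx → IBondY x.toKIdx)
    (hbI0 : ∀ (x : MemberY θ.d₆ θ.ℓ₆ θ.hd' θ.hL' θ.b₀ θ.b₁ Mstar) (f : FBondY x.toKIdx), bI x f = bI x ⟨f.src, 0⟩)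
    (𝔗 : ∀ x : MemberY θ.d₆ θ.ℓ₆ θ.hd' θ.hL' θ.b₀ θ.b₁ Mstar, (bg9Y (Matrix (Fin N) (Fin N) ℂ) (specialUnitaryUnits (Fin N)) x).Cfg →
      (XBK (TrIdx N) x.toKIdx → ℝ) →ₗ[ℝ] (XHK (TrIdx N) x.toKIdx → ℝ))
    (WT : ∀ x : MemberY θ.d₆ θ.ℓ₆ θ.hd' θ.hL' θ.b₀ θ.b₁ Mstar, IBondY x.toKIdx → ℝ) (hWT : ∀ x c, 0 ≤ WT x c)
    {w₁ : ℝ} (hWη : ∀ (x : MemberY θ.d₆ θ.ℓ₆ θ.hd' θ.hL' θ.b₀ θ.b₁ Mstar) (c : IBondY x.toKIdx), etaDY x * (WT x c * ((geo9Y x).len c ^ 3)⁻¹) ≤ w₁)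
    (cJ BT δT ρR tHJ M a : ℝ) (hcJ : 0 ≤ cJ) (hBT : 0 ≤ BT) (hρR : 0 < ρR) (hM : 0 < M) (ha1 : cJ * a ≤ 1)
    (hδT : q.αF * ((1 - 2 * q.α) * q.δ₀) + ρR ≤ δT)
    (htHJ : N * basisBound39 (trBasis N) ^ 2 * (10 ^ 4 * ((θ.d₆ : ℝ) + 1) * cJ) * (((θ.d₆ : ℝ) + 1) * Fintype.card (TrIdx N) * BT) *
      ((((θ.ℓ₆ + 1 : ℕ) : ℝ) ^ 3) * rowConst261 (geo9Y (d := θ.d₆) (ℓ := θ.ℓ₆) (hd := θ.hd') (hL := θ.hL') (b₀ := θ.b₀) (b₁ := θ.b₁) (Mstar := Mstar)) ρR) ≤ tHJ)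
    (hH1T : ∀ x : MemberY θ.d₆ θ.ℓ₆ θ.hd' θ.hL' θ.b₀ θ.b₁ Mstar, M ≤ (geo9Y x).M → ∀ α₀ : ℝ, 0 < α₀ → (geo9Y x).M * α₀ ≤ a →
      ∀ U : (bg9Y (Matrix (Fin N) (Fin N) ℂ) (specialUnitaryUnits (Fin N)) x).Cfg,
        (bg9YR (Matrix (Fin N) (Fin N) ℂ) (specialUnitaryUnits (Fin N)) R₁ R₂ x).Reg335 c α₀ U →
        (bg9YR (Matrix (Fin N) (Fin N) ℂ) (specialUnitaryUnits (Fin N)) R₁ R₂ x).Reg336 c α₀ U →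
          IsTransposePair (HcoK x.toKIdx (trBasis N) (bg9Y (Matrix (Fin N) (Fin N) ℂ) (specialUnitaryUnits (Fin N)) x) (fun U => U)
              (H1Y x.toKIdx (parSymY x.toKIdx) (parBY x.toKIdx) (GpPhysY x.toKIdx (parSymY x.toKIdx)) (𝔯 x).Δ2) U) (𝔗 x U) ∧
            HasMajorantHom (g := toB6 (geo9Y x) 1 (H x)) (fun p : XBK (TrIdx N) x.toKIdx => bI x p.1) (fun p : XHK (TrIdx N) x.toKIdx => p.1) (𝔗 x U)
              (fun c y' => BT * WT x c * Real.exp (-(δT * (geo9Y x).dist c y'))))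
    (hreg : ∀ x : MemberY θ.d₆ θ.ℓ₆ θ.hd' θ.hL' θ.b₀ θ.b₁ Mstar, M ≤ (geo9Y x).M → ∀ α₀ : ℝ, 0 < α₀ → (geo9Y x).M * α₀ ≤ a →
      ∀ U : (bg9Y (Matrix (Fin N) (Fin N) ℂ) (specialUnitaryUnits (Fin N)) x).Cfg,
        (bg9YR (Matrix (Fin N) (Fin N) ℂ) (specialUnitaryUnits (Fin N)) R₁ R₂ x).Reg335 c α₀ U →
        (bg9YR (Matrix (Fin N) (Fin N) ℂ) (specialUnitaryUnits (Fin N)) R₁ R₂ x).Reg336 c α₀ U →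
          ∀ μ s, RegularAt (shiftsV1 (PV θ.d₆ θ.ℓ₆ x.toKIdx.m x.toKIdx.K θ.hd' θ.hL')) U (etaBY x.toKIdx)
            (cJ * ((geo9Y x).M * α₀)) ((geo9Y x).len (bI x ⟨s, 0⟩)) μ s) :
    ∃ MH : ℝ, ∀ x : MemberY θ.d₆ θ.ℓ₆ θ.hd' θ.hL' θ.b₀ θ.b₁ Mstar, MH ≤ (geo9Y x).M → M ≤ (geo9Y x).M → ∀ α₀ : ℝ, 0 < α₀ → (geo9Y x).M * α₀ ≤ a →
      ∀ U : (bg9Y (Matrix (Fin N) (Fin N) ℂ) (specialUnitaryUnits (Fin N)) x).Cfg,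
        (bg9YR (Matrix (Fin N) (Fin N) ℂ) (specialUnitaryUnits (Fin N)) R₁ R₂ x).Reg335 c α₀ U →
        (bg9YR (Matrix (Fin N) (Fin N) ℂ) (specialUnitaryUnits (Fin N)) R₁ R₂ x).Reg336 c α₀ U →
          ∀ c : IBondY x.toKIdx,
            etaDY x * ‖trAdjY (trDualMatY N) (H1Y x.toKIdx (parSymY x.toKIdx) (parBY x.toKIdx) (GpPhysY x.toKIdx (parSymY x.toKIdx)) (𝔯 x).Δ2 U)
              (JY x.toKIdx U) c‖ ≤ tHJ * a * w₁ :=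
  etaDY_mul_norm_trAdjY_JY_le_of_transpose_schemas_wR q hq H R₁ R₂ c
    (fun x => H1Y x.toKIdx (parSymY x.toKIdx) (parBY x.toKIdx) (GpPhysY x.toKIdx (parSymY x.toKIdx)) (𝔯 x).Δ2) bI hbI0 𝔗 WT hWT hWη
    cJ BT δT ρR tHJ M a hcJ hBT hρR hM ha1 hδT htHJ hH1T hreg

end H1

/-! ## §5 (v1.1, APPEND-ONLY) The two law-free faces of §4: `W_T ≡ 1` and the block-count weight, `w₁ = 1`, for `3 ≤ d+1` -/

section H1Laws

variable [NeZero N]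
variable [∀ x : MemberY θ.d₆ θ.ℓ₆ θ.hd' θ.hL' θ.b₀ θ.b₁ Mstar, Fintype (geo9Y x).Site]

/-- ★★ **§4 AT THE UNWEIGHTED TRANSPOSE SCHEMA (`W_T ≡ 1`), NO WEIGHT LAW DISPLAYED**: for `3 ≤ d+1` the law is §1's `etaDY_mul_inv_len_cube_le_one` and the bound reads
`η^{d+1}·‖(H₁(U)†J(U))(c)‖ ≤ t_{HJ}·a` (n06-w8's F8 «bounded-level» form of the schema; member-uniformly inhabitable only with a weight — F8′).
[cite: Balaban1985BackgroundPropagators, (3.129) p.421, p.422 (the sentence between (3.136) and (3.137)), (3.136) p.422, (3.133) p.422, (3.36) p.396; Balaban1984PropagatorsII, (2.51) p.232, Lemma 2.1 (2.60)–(2.61) pp.233–234] -/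
theorem etaDY_mul_norm_trAdjY_H1Y_JY_le_of_transpose_schemas_w1 (hD : 3 ≤ θ.d₆ + 1) (q : PinPrims) (hq : q.OK) (H : MemberY θ.d₆ θ.ℓ₆ θ.hd' θ.hL' θ.b₀ θ.b₁ Mstar → Prop)
    (R₁ R₂ : RegFamY θ.d₆ θ.ℓ₆ θ.hd' θ.hL' θ.b₀ θ.b₁ Mstar (Matrix (Fin N) (Fin N) ℂ)) (c : ℝ) (𝔯 : ResY N θ Mstar)
    (bI : ∀ x : MemberY θ.d₆ θ.ℓ₆ θ.hd' θ.hL' θ.b₀ θ.b₁ Mstar, FBondY x.toKIdx → IBondY x.toKIdx)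
    (hbI0 : ∀ (x : MemberY θ.d₆ θ.ℓ₆ θ.hd' θ.hL' θ.b₀ θ.b₁ Mstar) (f : FBondY x.toKIdx), bI x f = bI x ⟨f.src, 0⟩)
    (𝔗 : ∀ x : MemberY θ.d₆ θ.ℓ₆ θ.hd' θ.hL' θ.b₀ θ.b₁ Mstar, (bg9Y (Matrix (Fin N) (Fin N) ℂ) (specialUnitaryUnits (Fin N)) x).Cfg →
      (XBK (TrIdx N) x.toKIdx → ℝ) →ₗ[ℝ] (XHK (TrIdx N) x.toKIdx → ℝ))
    (cJ BT δT ρR tHJ M a : ℝ) (hcJ : 0 ≤ cJ) (hBT : 0 ≤ BT) (hρR : 0 < ρR) (hM : 0 < M) (ha1 : cJ * a ≤ 1)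
    (hδT : q.αF * ((1 - 2 * q.α) * q.δ₀) + ρR ≤ δT)
    (htHJ : N * basisBound39 (trBasis N) ^ 2 * (10 ^ 4 * ((θ.d₆ : ℝ) + 1) * cJ) * (((θ.d₆ : ℝ) + 1) * Fintype.card (TrIdx N) * BT) *
      ((((θ.ℓ₆ + 1 : ℕ) : ℝ) ^ 3) * rowConst261 (geo9Y (d := θ.d₆) (ℓ := θ.ℓ₆) (hd := θ.hd') (hL := θ.hL') (b₀ := θ.b₀) (b₁ := θ.b₁) (Mstar := Mstar)) ρR) ≤ tHJ)
    (hH1T : ∀ x : MemberY θ.d₆ θ.ℓ₆ θ.hd' θ.hL' θ.b₀ θ.b₁ Mstar, M ≤ (geo9Y x).M → ∀ α₀ : ℝ, 0 < α₀ → (geo9Y x).M * α₀ ≤ a →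
      ∀ U : (bg9Y (Matrix (Fin N) (Fin N) ℂ) (specialUnitaryUnits (Fin N)) x).Cfg,
        (bg9YR (Matrix (Fin N) (Fin N) ℂ) (specialUnitaryUnits (Fin N)) R₁ R₂ x).Reg335 c α₀ U →
        (bg9YR (Matrix (Fin N) (Fin N) ℂ) (specialUnitaryUnits (Fin N)) R₁ R₂ x).Reg336 c α₀ U →
          IsTransposePair (HcoK x.toKIdx (trBasis N) (bg9Y (Matrix (Fin N) (Fin N) ℂ) (specialUnitaryUnits (Fin N)) x) (fun U => U)
              (H1Y x.toKIdx (parSymY x.toKIdx) (parBY x.toKIdx) (GpPhysY x.toKIdx (parSymY x.toKIdx)) (𝔯 x).Δ2) U) (𝔗 x U) ∧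
            HasMajorantHom (g := toB6 (geo9Y x) 1 (H x)) (fun p : XBK (TrIdx N) x.toKIdx => bI x p.1) (fun p : XHK (TrIdx N) x.toKIdx => p.1) (𝔗 x U)
              (fun c y' => BT * 1 * Real.exp (-(δT * (geo9Y x).dist c y'))))
    (hreg : ∀ x : MemberY θ.d₆ θ.ℓ₆ θ.hd' θ.hL' θ.b₀ θ.b₁ Mstar, M ≤ (geo9Y x).M → ∀ α₀ : ℝ, 0 < α₀ → (geo9Y x).M * α₀ ≤ a →
      ∀ U : (bg9Y (Matrix (Fin N) (Fin N) ℂ) (specialUnitaryUnits (Fin N)) x).Cfg,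
        (bg9YR (Matrix (Fin N) (Fin N) ℂ) (specialUnitaryUnits (Fin N)) R₁ R₂ x).Reg335 c α₀ U →
        (bg9YR (Matrix (Fin N) (Fin N) ℂ) (specialUnitaryUnits (Fin N)) R₁ R₂ x).Reg336 c α₀ U →
          ∀ μ s, RegularAt (shiftsV1 (PV θ.d₆ θ.ℓ₆ x.toKIdx.m x.toKIdx.K θ.hd' θ.hL')) U (etaBY x.toKIdx)
            (cJ * ((geo9Y x).M * α₀)) ((geo9Y x).len (bI x ⟨s, 0⟩)) μ s) :
    ∃ MH : ℝ, ∀ x : MemberY θ.d₆ θ.ℓ₆ θ.hd' θ.hL' θ.b₀ θ.b₁ Mstar, MH ≤ (geo9Y x).M → M ≤ (geo9Y x).M → ∀ α₀ : ℝ, 0 < α₀ → (geo9Y x).M * α₀ ≤ a →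
      ∀ U : (bg9Y (Matrix (Fin N) (Fin N) ℂ) (specialUnitaryUnits (Fin N)) x).Cfg,
        (bg9YR (Matrix (Fin N) (Fin N) ℂ) (specialUnitaryUnits (Fin N)) R₁ R₂ x).Reg335 c α₀ U →
        (bg9YR (Matrix (Fin N) (Fin N) ℂ) (specialUnitaryUnits (Fin N)) R₁ R₂ x).Reg336 c α₀ U →
          ∀ c : IBondY x.toKIdx,
            etaDY x * ‖trAdjY (trDualMatY N) (H1Y x.toKIdx (parSymY x.toKIdx) (parBY x.toKIdx) (GpPhysY x.toKIdx (parSymY x.toKIdx)) (𝔯 x).Δ2 U)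
              (JY x.toKIdx U) c‖ ≤ tHJ * a * 1 :=
  etaDY_mul_norm_trAdjY_H1Y_JY_le_of_transpose_schemas_wR q hq H R₁ R₂ c 𝔯 bI hbI0 𝔗 (fun _ _ => (1 : ℝ)) (fun _ _ => zero_le_one)
    (fun x c => by rw [one_mul]; exact etaDY_mul_inv_len_cube_le_one hD x c) cJ BT δT ρR tHJ M a hcJ hBT hρR hM ha1 hδT htHJ hH1T hreg

/-- ★★ **§4 AT THE BLOCK-COUNT WEIGHT `W_T(c) = n_c := ((Lʲη)_c∕η)^{d+1}`, NO WEIGHT LAW DISPLAYED**: for `3 ≤ d+1` the law is §1's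
`etaDY_mul_blockCount_mul_inv_len_cube_le_one` and the bound reads `η^{d+1}·‖(H₁(U)†J(U))(c)‖ ≤ t_{HJ}·a` (the member-uniformly inhabitable form of the schema, n06-w8 F8′:
at the flat record the transpose `(C₁ ∘ Q) ∘ G₁` carries the block count at the coarse end).
[cite: Balaban1985BackgroundPropagators, (3.129) p.421, p.422 (the sentence between (3.136) and (3.137)), (3.136) p.422, (3.133) p.422, (3.36) p.396, (3.41) p.397; Balaban1984PropagatorsII, (2.51) p.232, Lemma 2.1 (2.60)–(2.61) pp.233–234] -/
theorem etaDY_mul_norm_trAdjY_H1Y_JY_le_of_transpose_schemas_blockCount (hD : 3 ≤ θ.d₆ + 1) (q : PinPrims) (hq : q.OK) (H : MemberY θ.d₆ θ.ℓ₆ θ.hd' θ.hL' θ.b₀ θ.b₁ Mstar → Prop)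
    (R₁ R₂ : RegFamY θ.d₆ θ.ℓ₆ θ.hd' θ.hL' θ.b₀ θ.b₁ Mstar (Matrix (Fin N) (Fin N) ℂ)) (c : ℝ) (𝔯 : ResY N θ Mstar)
    (bI : ∀ x : MemberY θ.d₆ θ.ℓ₆ θ.hd' θ.hL' θ.b₀ θ.b₁ Mstar, FBondY x.toKIdx → IBondY x.toKIdx)
    (hbI0 : ∀ (x : MemberY θ.d₆ θ.ℓ₆ θ.hd' θ.hL' θ.b₀ θ.b₁ Mstar) (f : FBondY x.toKIdx), bI x f = bI x ⟨f.src, 0⟩)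
    (𝔗 : ∀ x : MemberY θ.d₆ θ.ℓ₆ θ.hd' θ.hL' θ.b₀ θ.b₁ Mstar, (bg9Y (Matrix (Fin N) (Fin N) ℂ) (specialUnitaryUnits (Fin N)) x).Cfg →
      (XBK (TrIdx N) x.toKIdx → ℝ) →ₗ[ℝ] (XHK (TrIdx N) x.toKIdx → ℝ))
    (cJ BT δT ρR tHJ M a : ℝ) (hcJ : 0 ≤ cJ) (hBT : 0 ≤ BT) (hρR : 0 < ρR) (hM : 0 < M) (ha1 : cJ * a ≤ 1)
    (hδT : q.αF * ((1 - 2 * q.α) * q.δ₀) + ρR ≤ δT)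
    (htHJ : N * basisBound39 (trBasis N) ^ 2 * (10 ^ 4 * ((θ.d₆ : ℝ) + 1) * cJ) * (((θ.d₆ : ℝ) + 1) * Fintype.card (TrIdx N) * BT) *
      ((((θ.ℓ₆ + 1 : ℕ) : ℝ) ^ 3) * rowConst261 (geo9Y (d := θ.d₆) (ℓ := θ.ℓ₆) (hd := θ.hd') (hL := θ.hL') (b₀ := θ.b₀) (b₁ := θ.b₁) (Mstar := Mstar)) ρR) ≤ tHJ)
    (hH1T : ∀ x : MemberY θ.d₆ θ.ℓ₆ θ.hd' θ.hL' θ.b₀ θ.b₁ Mstar, M ≤ (geo9Y x).M → ∀ α₀ : ℝ, 0 < α₀ → (geo9Y x).M * α₀ ≤ a →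
      ∀ U : (bg9Y (Matrix (Fin N) (Fin N) ℂ) (specialUnitaryUnits (Fin N)) x).Cfg,
        (bg9YR (Matrix (Fin N) (Fin N) ℂ) (specialUnitaryUnits (Fin N)) R₁ R₂ x).Reg335 c α₀ U →
        (bg9YR (Matrix (Fin N) (Fin N) ℂ) (specialUnitaryUnits (Fin N)) R₁ R₂ x).Reg336 c α₀ U →
          IsTransposePair (HcoK x.toKIdx (trBasis N) (bg9Y (Matrix (Fin N) (Fin N) ℂ) (specialUnitaryUnits (Fin N)) x) (fun U => U)
              (H1Y x.toKIdx (parSymY x.toKIdx) (parBY x.toKIdx) (GpPhysY x.toKIdx (parSymY x.toKIdx)) (𝔯 x).Δ2) U) (𝔗 x U) ∧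
            HasMajorantHom (g := toB6 (geo9Y x) 1 (H x)) (fun p : XBK (TrIdx N) x.toKIdx => bI x p.1) (fun p : XHK (TrIdx N) x.toKIdx => p.1) (𝔗 x U)
              (fun c y' => BT * (((geo9Y x).len c / etaBY x.toKIdx) ^ (θ.d₆ + 1)) * Real.exp (-(δT * (geo9Y x).dist c y'))))
    (hreg : ∀ x : MemberY θ.d₆ θ.ℓ₆ θ.hd' θ.hL' θ.b₀ θ.b₁ Mstar, M ≤ (geo9Y x).M → ∀ α₀ : ℝ, 0 < α₀ → (geo9Y x).M * α₀ ≤ a →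
      ∀ U : (bg9Y (Matrix (Fin N) (Fin N) ℂ) (specialUnitaryUnits (Fin N)) x).Cfg,
        (bg9YR (Matrix (Fin N) (Fin N) ℂ) (specialUnitaryUnits (Fin N)) R₁ R₂ x).Reg335 c α₀ U →
        (bg9YR (Matrix (Fin N) (Fin N) ℂ) (specialUnitaryUnits (Fin N)) R₁ R₂ x).Reg336 c α₀ U →
          ∀ μ s, RegularAt (shiftsV1 (PV θ.d₆ θ.ℓ₆ x.toKIdx.m x.toKIdx.K θ.hd' θ.hL')) U (etaBY x.toKIdx)
            (cJ * ((geo9Y x).M * α₀)) ((geo9Y x).len (bI x ⟨s, 0⟩)) μ s) :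
    ∃ MH : ℝ, ∀ x : MemberY θ.d₆ θ.ℓ₆ θ.hd' θ.hL' θ.b₀ θ.b₁ Mstar, MH ≤ (geo9Y x).M → M ≤ (geo9Y x).M → ∀ α₀ : ℝ, 0 < α₀ → (geo9Y x).M * α₀ ≤ a →
      ∀ U : (bg9Y (Matrix (Fin N) (Fin N) ℂ) (specialUnitaryUnits (Fin N)) x).Cfg,
        (bg9YR (Matrix (Fin N) (Fin N) ℂ) (specialUnitaryUnits (Fin N)) R₁ R₂ x).Reg335 c α₀ U →
        (bg9YR (Matrix (Fin N) (Fin N) ℂ) (specialUnitaryUnits (Fin N)) R₁ R₂ x).Reg336 c α₀ U →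
          ∀ c : IBondY x.toKIdx,
            etaDY x * ‖trAdjY (trDualMatY N) (H1Y x.toKIdx (parSymY x.toKIdx) (parBY x.toKIdx) (GpPhysY x.toKIdx (parSymY x.toKIdx)) (𝔯 x).Δ2 U)
              (JY x.toKIdx U) c‖ ≤ tHJ * a * 1 :=
  etaDY_mul_norm_trAdjY_H1Y_JY_le_of_transpose_schemas_wR q hq H R₁ R₂ c 𝔯 bI hbI0 𝔗
    (fun x c => ((geo9Y x).len c / etaBY x.toKIdx) ^ (θ.d₆ + 1))
    (fun x c => pow_nonneg (div_nonneg (geo9Y_len_pos x c).le (etaBY_pos' x).le) _)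
    (fun x c => etaDY_mul_blockCount_mul_inv_len_cube_le_one hD x c) cJ BT δT ρR tHJ M a hcJ hBT hρR hM ha1 hδT htHJ hH1T hreg

end H1Laws

/-! ## §6 (v1.2, APPEND-ONLY) The print-unit face with the weight law asked ONLY ON A DISPLAYED SUPPORT `S` of coarse bonds; the law value of the CLASS weight

WHY (seat dag-n08-d g44, LOCATED 2026-08-29).  The only typed inhabitant road for a weighted coarse letter at the record — a `𝔠⁽²⁾ → Z_{n⁻¹}` class letter
((3.132) species, e.g. n06-w5's `B9LettersZCFieldsAtPins.c12_pins`) read through n06-w8's F11 `B9SupLettersFromClassLetters.hasMajorantHom_of_hasMaj_cNorm_weightNorm`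
— produces the CLASS WEIGHT `W(c) = K·n_c·(Lʲη)_c⁻²` (`n_c = ((Lʲη)_c∕η)^{d+1}`), for which §3's law value is `η^{d+1}·(W(c)·((Lʲη)_c³)⁻¹) = K·(Lʲη)_c^{d+1}·((Lʲη)_c⁵)⁻¹`
(`etaDY_mul_classWeight_mul_inv_len_cube_eq`): bounded by `K` for `5 ≤ d+1`, and at `d+1 = 4` equal to `K·(Lʲη)_c⁻¹ ∈ [K, K·η⁻¹]` — NOT uniformly bounded over
all coarse bonds `c`.  The consumer of the (b†) face ([B9] (3.156): the `J`-term `2⟨H₁D̃⁽²⁾(B), J⟩`) needs it only on the output support of `D̃⁽²⁾`, which print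
restricts to unit blocks (p. 427: *«D̃⁽²⁾(B) … restricted to unit blocks»*), where `(Lʲη)_c = 1` and the law value IS `K` (`…_of_len_eq_one`).  Hence the
`S`-restricted faces `…_wR_on` below (§3 ∕ §4 verbatim with the law asked, and the bound concluded, on `S x c` only). -/

section ClassWeight

/-- ★ **THE LAW VALUE OF THE CLASS WEIGHT**: with `W(c) := K·(((Lʲη)_c∕η)^{d+1}·((Lʲη)_c²)⁻¹)` (block count times `(Lʲη)⁻²` — the output weight of a `𝔠⁽²⁾ → Z_{n⁻¹}`
class letter read as a [4]-(2.51) sup majorant, n06-w8 F11 §2), `η^{d+1}·(W(c)·((Lʲη)_c³)⁻¹) = K·((Lʲη)_c^{d+1}·((Lʲη)_c⁵)⁻¹)` — the (d+1)−5 exponent.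
[cite: Balaban1985BackgroundPropagators, (3.132) p.422, (3.13) p.392, (3.41) p.397, p.398 (remark after (3.47)); Balaban1984PropagatorsII, (2.51) p.232, bookkeeping] -/
theorem etaDY_mul_classWeight_mul_inv_len_cube_eq (x : MemberY θ.d₆ θ.ℓ₆ θ.hd' θ.hL' θ.b₀ θ.b₁ Mstar) (c : (geo9Y x).Site) (K : ℝ) :
    etaDY x * ((K * (((geo9Y x).len c / etaBY x.toKIdx) ^ (θ.d₆ + 1) * ((geo9Y x).len c ^ 2)⁻¹)) * ((geo9Y x).len c ^ 3)⁻¹) =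
      K * ((geo9Y x).len c ^ (θ.d₆ + 1) * ((geo9Y x).len c ^ 5)⁻¹) := by
  have hη0 := etaBY_pos' x
  have hlen0 := geo9Y_len_pos x c
  rw [etaDY_eq_etaBY_pow, div_pow]
  field_simp

/-- ★ **… ON A UNIT BLOCK IT IS `K`**: if `(Lʲη)_c = 1` (a top-level coarse bond — `B1Eq324BenfattoClassSectEMemberPRowDictionaryAtNode00.len_eq_one_of_lvl_eq`), the law
value of the class weight is `K`, for EVERY dimension. [cite: Balaban1985BackgroundPropagators, p.427 («restricted to unit blocks»), (3.132) p.422, (3.13) p.392, bookkeeping] -/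
theorem etaDY_mul_classWeight_mul_inv_len_cube_eq_of_len_eq_one (x : MemberY θ.d₆ θ.ℓ₆ θ.hd' θ.hL' θ.b₀ θ.b₁ Mstar) (c : (geo9Y x).Site) (K : ℝ)
    (hc : (geo9Y x).len c = 1) :
    etaDY x * ((K * (((geo9Y x).len c / etaBY x.toKIdx) ^ (θ.d₆ + 1) * ((geo9Y x).len c ^ 2)⁻¹)) * ((geo9Y x).len c ^ 3)⁻¹) = K := by
  rw [etaDY_mul_classWeight_mul_inv_len_cube_eq, hc, one_pow, one_pow, inv_one, mul_one, mul_one]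

end ClassWeight

section OnSupport

variable [NeZero N]
variable [∀ x : MemberY θ.d₆ θ.ℓ₆ θ.hd' θ.hL' θ.b₀ θ.b₁ Mstar, Fintype (geo9Y x).Site]

/-- ★★ **THE PRINT-UNIT FACE WITH THE WEIGHT LAW ASKED ONLY ON A DISPLAYED SUPPORT `S`** (§3 verbatim, the law `η^{d+1}·(W_T x c·((Lʲη)_c³)⁻¹) ≤ w₁` asked for the
coarse bonds `c` with `S x c` and the bound `η^{d+1}·‖(O(U)†J(U))(c)‖ ≤ t_{HJ}·a·w₁` concluded for those `c`; §2 is pointwise in `c`).  At `S := ⊤` it is §3; at the top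
level with the class weight the law is `…_of_len_eq_one`.
[cite: Balaban1985BackgroundPropagators, p.422 (the sentence between (3.136) and (3.137)), p.427 («restricted to unit blocks»), (3.13) p.392, (3.156) p.428, (3.133) p.422, (3.36) p.396; Balaban1984PropagatorsII, (2.51) p.232, Lemma 2.1 (2.60)–(2.61) pp.233–234] -/
theorem etaDY_mul_norm_trAdjY_JY_le_of_transpose_schemas_wR_on (q : PinPrims) (hq : q.OK) (H : MemberY θ.d₆ θ.ℓ₆ θ.hd' θ.hL' θ.b₀ θ.b₁ Mstar → Prop)
    (R₁ R₂ : RegFamY θ.d₆ θ.ℓ₆ θ.hd' θ.hL' θ.b₀ θ.b₁ Mstar (Matrix (Fin N) (Fin N) ℂ)) (c : ℝ)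
    (O : ∀ x : MemberY θ.d₆ θ.ℓ₆ θ.hd' θ.hL' θ.b₀ θ.b₁ Mstar,
      CfgY (Matrix (Fin N) (Fin N) ℂ) x.toKIdx → (IBondY x.toKIdx → Matrix (Fin N) (Fin N) ℂ) →ₗ[ℂ] (FBondY x.toKIdx → Matrix (Fin N) (Fin N) ℂ))
    (bI : ∀ x : MemberY θ.d₆ θ.ℓ₆ θ.hd' θ.hL' θ.b₀ θ.b₁ Mstar, FBondY x.toKIdx → IBondY x.toKIdx)
    (hbI0 : ∀ (x : MemberY θ.d₆ θ.ℓ₆ θ.hd' θ.hL' θ.b₀ θ.b₁ Mstar) (f : FBondY x.toKIdx), bI x f = bI x ⟨f.src, 0⟩)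
    (𝔗 : ∀ x : MemberY θ.d₆ θ.ℓ₆ θ.hd' θ.hL' θ.b₀ θ.b₁ Mstar, (bg9Y (Matrix (Fin N) (Fin N) ℂ) (specialUnitaryUnits (Fin N)) x).Cfg →
      (XBK (TrIdx N) x.toKIdx → ℝ) →ₗ[ℝ] (XHK (TrIdx N) x.toKIdx → ℝ))
    (WT : ∀ x : MemberY θ.d₆ θ.ℓ₆ θ.hd' θ.hL' θ.b₀ θ.b₁ Mstar, IBondY x.toKIdx → ℝ) (hWT : ∀ x c, 0 ≤ WT x c)
    (S : ∀ x : MemberY θ.d₆ θ.ℓ₆ θ.hd' θ.hL' θ.b₀ θ.b₁ Mstar, IBondY x.toKIdx → Prop)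
    {w₁ : ℝ} (hWηS : ∀ (x : MemberY θ.d₆ θ.ℓ₆ θ.hd' θ.hL' θ.b₀ θ.b₁ Mstar) (c : IBondY x.toKIdx), S x c → etaDY x * (WT x c * ((geo9Y x).len c ^ 3)⁻¹) ≤ w₁)
    (cJ BT δT ρR tHJ M a : ℝ) (hcJ : 0 ≤ cJ) (hBT : 0 ≤ BT) (hρR : 0 < ρR) (hM : 0 < M) (ha1 : cJ * a ≤ 1)
    (hδT : q.αF * ((1 - 2 * q.α) * q.δ₀) + ρR ≤ δT)
    (htHJ : N * basisBound39 (trBasis N) ^ 2 * (10 ^ 4 * ((θ.d₆ : ℝ) + 1) * cJ) * (((θ.d₆ : ℝ) + 1) * Fintype.card (TrIdx N) * BT) *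
      ((((θ.ℓ₆ + 1 : ℕ) : ℝ) ^ 3) * rowConst261 (geo9Y (d := θ.d₆) (ℓ := θ.ℓ₆) (hd := θ.hd') (hL := θ.hL') (b₀ := θ.b₀) (b₁ := θ.b₁) (Mstar := Mstar)) ρR) ≤ tHJ)
    (hOT : ∀ x : MemberY θ.d₆ θ.ℓ₆ θ.hd' θ.hL' θ.b₀ θ.b₁ Mstar, M ≤ (geo9Y x).M → ∀ α₀ : ℝ, 0 < α₀ → (geo9Y x).M * α₀ ≤ a →
      ∀ U : (bg9Y (Matrix (Fin N) (Fin N) ℂ) (specialUnitaryUnits (Fin N)) x).Cfg,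
        (bg9YR (Matrix (Fin N) (Fin N) ℂ) (specialUnitaryUnits (Fin N)) R₁ R₂ x).Reg335 c α₀ U →
        (bg9YR (Matrix (Fin N) (Fin N) ℂ) (specialUnitaryUnits (Fin N)) R₁ R₂ x).Reg336 c α₀ U →
          IsTransposePair (HcoK x.toKIdx (trBasis N) (bg9Y (Matrix (Fin N) (Fin N) ℂ) (specialUnitaryUnits (Fin N)) x) (fun U => U) (O x) U) (𝔗 x U) ∧
            HasMajorantHom (g := toB6 (geo9Y x) 1 (H x)) (fun p : XBK (TrIdx N) x.toKIdx => bI x p.1) (fun p : XHK (TrIdx N) x.toKIdx => p.1) (𝔗 x U)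
              (fun c y' => BT * WT x c * Real.exp (-(δT * (geo9Y x).dist c y'))))
    (hreg : ∀ x : MemberY θ.d₆ θ.ℓ₆ θ.hd' θ.hL' θ.b₀ θ.b₁ Mstar, M ≤ (geo9Y x).M → ∀ α₀ : ℝ, 0 < α₀ → (geo9Y x).M * α₀ ≤ a →
      ∀ U : (bg9Y (Matrix (Fin N) (Fin N) ℂ) (specialUnitaryUnits (Fin N)) x).Cfg,
        (bg9YR (Matrix (Fin N) (Fin N) ℂ) (specialUnitaryUnits (Fin N)) R₁ R₂ x).Reg335 c α₀ U →
        (bg9YR (Matrix (Fin N) (Fin N) ℂ) (specialUnitaryUnits (Fin N)) R₁ R₂ x).Reg336 c α₀ U →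
          ∀ μ s, RegularAt (shiftsV1 (PV θ.d₆ θ.ℓ₆ x.toKIdx.m x.toKIdx.K θ.hd' θ.hL')) U (etaBY x.toKIdx)
            (cJ * ((geo9Y x).M * α₀)) ((geo9Y x).len (bI x ⟨s, 0⟩)) μ s) :
    ∃ MH : ℝ, ∀ x : MemberY θ.d₆ θ.ℓ₆ θ.hd' θ.hL' θ.b₀ θ.b₁ Mstar, MH ≤ (geo9Y x).M → M ≤ (geo9Y x).M → ∀ α₀ : ℝ, 0 < α₀ → (geo9Y x).M * α₀ ≤ a →
      ∀ U : (bg9Y (Matrix (Fin N) (Fin N) ℂ) (specialUnitaryUnits (Fin N)) x).Cfg,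
        (bg9YR (Matrix (Fin N) (Fin N) ℂ) (specialUnitaryUnits (Fin N)) R₁ R₂ x).Reg335 c α₀ U →
        (bg9YR (Matrix (Fin N) (Fin N) ℂ) (specialUnitaryUnits (Fin N)) R₁ R₂ x).Reg336 c α₀ U →
          ∀ c : IBondY x.toKIdx, S x c → etaDY x * ‖trAdjY (trDualMatY N) (O x U) (JY x.toKIdx U) c‖ ≤ tHJ * a * w₁ := by
  obtain ⟨MH, hMH⟩ := norm_trAdjY_JY_le_of_transpose_schemas_wR q hq H R₁ R₂ c O bI hbI0 𝔗 WT hWT cJ BT δT ρR tHJ M a hcJ hBT hρR hM ha1 hδT htHJ hOT hreg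
  refine ⟨MH, fun x hMx hMM α₀ hα ha U hU hU' c hSc => ?_⟩
  have h := hMH x hMx hMM α₀ hα ha U hU hU' c
  have hη : 0 ≤ etaDY x := (Node00.etaDY_pos x).le
  have htHJ0 : 0 ≤ tHJ := le_trans (by
    have := rowConst261_nonneg (geo9Y (d := θ.d₆) (ℓ := θ.ℓ₆) (hd := θ.hd') (hL := θ.hL') (b₀ := θ.b₀) (b₁ := θ.b₁) (Mstar := Mstar)) ρR
    positivity) htHJ
  have hθ : 0 ≤ (geo9Y x).M * α₀ := mul_nonneg (hM.le.trans hMM) hα.le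
  have hw : 0 ≤ WT x c * ((geo9Y x).len c ^ 3)⁻¹ := mul_nonneg (hWT x c) (inv_nonneg.mpr (pow_nonneg (geo9Y_len_pos x c).le 3))
  calc etaDY x * ‖trAdjY (trDualMatY N) (O x U) (JY x.toKIdx U) c‖
      ≤ etaDY x * (tHJ * ((geo9Y x).M * α₀) * (WT x c * ((geo9Y x).len c ^ 3)⁻¹)) := mul_le_mul_of_nonneg_left h hη
    _ = tHJ * ((geo9Y x).M * α₀) * (etaDY x * (WT x c * ((geo9Y x).len c ^ 3)⁻¹)) := by ring
    _ ≤ tHJ * a * w₁ := by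
        have h1 : tHJ * ((geo9Y x).M * α₀) ≤ tHJ * a := mul_le_mul_of_nonneg_left ha htHJ0
        have h2 : 0 ≤ tHJ * a := le_trans (mul_nonneg htHJ0 hθ) h1
        calc tHJ * ((geo9Y x).M * α₀) * (etaDY x * (WT x c * ((geo9Y x).len c ^ 3)⁻¹))
            ≤ tHJ * a * (etaDY x * (WT x c * ((geo9Y x).len c ^ 3)⁻¹)) := mul_le_mul_of_nonneg_right h1 (mul_nonneg hη hw)
          _ ≤ tHJ * a * w₁ := mul_le_mul_of_nonneg_left (hWηS x c hSc) h2

/-- ★★ **§4's (b†) FACE ON A DISPLAYED SUPPORT `S`** — `…_wR_on` at `O x := H1Y x.toKIdx (parSymY …) (parBY …) (GpPhysY … (parSymY …)) (𝔯 x).Δ2`: the 𝒥-row input of the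
(3.24) doors in the S-generic form of `…PrecisionDoorRecordV4PAdjCurrent` §1 (`hHJ : ∀ z, S z → η^{d+1}·‖(H₁(U)†J(U))(z)‖ ≤ j₁`, `j₁ := t_{HJ}·a·w₁`), the law asked on `S` only.
[cite: Balaban1985BackgroundPropagators, (3.129) p.421, p.422 (the sentence between (3.136) and (3.137)), p.427 («restricted to unit blocks»), (3.156) p.428, (3.133) p.422, (3.36) p.396; Balaban1984PropagatorsII, (2.51) p.232, Lemma 2.1 (2.60)–(2.61) pp.233–234] -/
theorem etaDY_mul_norm_trAdjY_H1Y_JY_le_of_transpose_schemas_wR_on (q : PinPrims) (hq : q.OK) (H : MemberY θ.d₆ θ.ℓ₆ θ.hd' θ.hL' θ.b₀ θ.b₁ Mstar → Prop)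
    (R₁ R₂ : RegFamY θ.d₆ θ.ℓ₆ θ.hd' θ.hL' θ.b₀ θ.b₁ Mstar (Matrix (Fin N) (Fin N) ℂ)) (c : ℝ) (𝔯 : ResY N θ Mstar)
    (bI : ∀ x : MemberY θ.d₆ θ.ℓ₆ θ.hd' θ.hL' θ.b₀ θ.b₁ Mstar, FBondY x.toKIdx → IBondY x.toKIdx)
    (hbI0 : ∀ (x : MemberY θ.d₆ θ.ℓ₆ θ.hd' θ.hL' θ.b₀ θ.b₁ Mstar) (f : FBondY x.toKIdx), bI x f = bI x ⟨f.src, 0⟩)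
    (𝔗 : ∀ x : MemberY θ.d₆ θ.ℓ₆ θ.hd' θ.hL' θ.b₀ θ.b₁ Mstar, (bg9Y (Matrix (Fin N) (Fin N) ℂ) (specialUnitaryUnits (Fin N)) x).Cfg →
      (XBK (TrIdx N) x.toKIdx → ℝ) →ₗ[ℝ] (XHK (TrIdx N) x.toKIdx → ℝ))
    (WT : ∀ x : MemberY θ.d₆ θ.ℓ₆ θ.hd' θ.hL' θ.b₀ θ.b₁ Mstar, IBondY x.toKIdx → ℝ) (hWT : ∀ x c, 0 ≤ WT x c)
    (S : ∀ x : MemberY θ.d₆ θ.ℓ₆ θ.hd' θ.hL' θ.b₀ θ.b₁ Mstar, IBondY x.toKIdx → Prop)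
    {w₁ : ℝ} (hWηS : ∀ (x : MemberY θ.d₆ θ.ℓ₆ θ.hd' θ.hL' θ.b₀ θ.b₁ Mstar) (c : IBondY x.toKIdx), S x c → etaDY x * (WT x c * ((geo9Y x).len c ^ 3)⁻¹) ≤ w₁)
    (cJ BT δT ρR tHJ M a : ℝ) (hcJ : 0 ≤ cJ) (hBT : 0 ≤ BT) (hρR : 0 < ρR) (hM : 0 < M) (ha1 : cJ * a ≤ 1)
    (hδT : q.αF * ((1 - 2 * q.α) * q.δ₀) + ρR ≤ δT)
    (htHJ : N * basisBound39 (trBasis N) ^ 2 * (10 ^ 4 * ((θ.d₆ : ℝ) + 1) * cJ) * (((θ.d₆ : ℝ) + 1) * Fintype.card (TrIdx N) * BT) *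
      ((((θ.ℓ₆ + 1 : ℕ) : ℝ) ^ 3) * rowConst261 (geo9Y (d := θ.d₆) (ℓ := θ.ℓ₆) (hd := θ.hd') (hL := θ.hL') (b₀ := θ.b₀) (b₁ := θ.b₁) (Mstar := Mstar)) ρR) ≤ tHJ)
    (hH1T : ∀ x : MemberY θ.d₆ θ.ℓ₆ θ.hd' θ.hL' θ.b₀ θ.b₁ Mstar, M ≤ (geo9Y x).M → ∀ α₀ : ℝ, 0 < α₀ → (geo9Y x).M * α₀ ≤ a →
      ∀ U : (bg9Y (Matrix (Fin N) (Fin N) ℂ) (specialUnitaryUnits (Fin N)) x).Cfg,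
        (bg9YR (Matrix (Fin N) (Fin N) ℂ) (specialUnitaryUnits (Fin N)) R₁ R₂ x).Reg335 c α₀ U →
        (bg9YR (Matrix (Fin N) (Fin N) ℂ) (specialUnitaryUnits (Fin N)) R₁ R₂ x).Reg336 c α₀ U →
          IsTransposePair (HcoK x.toKIdx (trBasis N) (bg9Y (Matrix (Fin N) (Fin N) ℂ) (specialUnitaryUnits (Fin N)) x) (fun U => U)
              (H1Y x.toKIdx (parSymY x.toKIdx) (parBY x.toKIdx) (GpPhysY x.toKIdx (parSymY x.toKIdx)) (𝔯 x).Δ2) U) (𝔗 x U) ∧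
            HasMajorantHom (g := toB6 (geo9Y x) 1 (H x)) (fun p : XBK (TrIdx N) x.toKIdx => bI x p.1) (fun p : XHK (TrIdx N) x.toKIdx => p.1) (𝔗 x U)
              (fun c y' => BT * WT x c * Real.exp (-(δT * (geo9Y x).dist c y'))))
    (hreg : ∀ x : MemberY θ.d₆ θ.ℓ₆ θ.hd' θ.hL' θ.b₀ θ.b₁ Mstar, M ≤ (geo9Y x).M → ∀ α₀ : ℝ, 0 < α₀ → (geo9Y x).M * α₀ ≤ a →
      ∀ U : (bg9Y (Matrix (Fin N) (Fin N) ℂ) (specialUnitaryUnits (Fin N)) x).Cfg,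
        (bg9YR (Matrix (Fin N) (Fin N) ℂ) (specialUnitaryUnits (Fin N)) R₁ R₂ x).Reg335 c α₀ U →
        (bg9YR (Matrix (Fin N) (Fin N) ℂ) (specialUnitaryUnits (Fin N)) R₁ R₂ x).Reg336 c α₀ U →
          ∀ μ s, RegularAt (shiftsV1 (PV θ.d₆ θ.ℓ₆ x.toKIdx.m x.toKIdx.K θ.hd' θ.hL')) U (etaBY x.toKIdx)
            (cJ * ((geo9Y x).M * α₀)) ((geo9Y x).len (bI x ⟨s, 0⟩)) μ s) :
    ∃ MH : ℝ, ∀ x : MemberY θ.d₆ θ.ℓ₆ θ.hd' θ.hL' θ.b₀ θ.b₁ Mstar, MH ≤ (geo9Y x).M → M ≤ (geo9Y x).M → ∀ α₀ : ℝ, 0 < α₀ → (geo9Y x).M * α₀ ≤ a →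
      ∀ U : (bg9Y (Matrix (Fin N) (Fin N) ℂ) (specialUnitaryUnits (Fin N)) x).Cfg,
        (bg9YR (Matrix (Fin N) (Fin N) ℂ) (specialUnitaryUnits (Fin N)) R₁ R₂ x).Reg335 c α₀ U →
        (bg9YR (Matrix (Fin N) (Fin N) ℂ) (specialUnitaryUnits (Fin N)) R₁ R₂ x).Reg336 c α₀ U →
          ∀ c : IBondY x.toKIdx, S x c →
            etaDY x * ‖trAdjY (trDualMatY N) (H1Y x.toKIdx (parSymY x.toKIdx) (parBY x.toKIdx) (GpPhysY x.toKIdx (parSymY x.toKIdx)) (𝔯 x).Δ2 U)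
              (JY x.toKIdx U) c‖ ≤ tHJ * a * w₁ :=
  etaDY_mul_norm_trAdjY_JY_le_of_transpose_schemas_wR_on q hq H R₁ R₂ c
    (fun x => H1Y x.toKIdx (parSymY x.toKIdx) (parBY x.toKIdx) (GpPhysY x.toKIdx (parSymY x.toKIdx)) (𝔯 x).Δ2) bI hbI0 𝔗 WT hWT S hWηS
    cJ BT δT ρR tHJ M a hcJ hBT hρR hM ha1 hδT htHJ hH1T hreg

end OnSupport

end Literature.MathematicalPhysics.QuantumFieldTheory.Balaban1983to89.B9Eq3136HstarJAtPinsLetterFamily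

end
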